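import Literature.AlgebraicGeometry.ComplexMultiplication.CyclotomicCMTypeCensusDegreeEight
import Literature.AlgebraicGeometry.ComplexMultiplication.CyclotomicCMTypeIsogenyClasses
import Literature.AlgebraicGeometry.ComplexMultiplication.SimpleIffPrimitiveCMType
import HarnessLib

/-!
# Abelian varieties with complex multiplication by a cyclotomic field of degree `8`: the SIMPLE ones form ONE isogeny class; isogeny classes
# = `Aut`-families of CM types

Layer `Literature/AlgebraicGeometry/ComplexMultiplication`, namespace `Literature.AlgebraicGeometry.ComplexMultiplication.CyclotomicCMTypeCensusDegreeEight`;
lane `lit-hodgefound` (Track 2 foundations library), prover seat `lit-hodgefound-p10`, generation 33, row «A3-(isogeny φ = 8)» (self-proposed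
2026-08-28).  Theorems only; no `def`, no instance, no named fact (net Literature debt 0).

For `K = ℚ(ζ_d)`, `φ(d) = 8` (`d ∈ {15, 16, 20, 24, 30}`), the censuses (`CyclotomicCMTypeCensusFifteen/Sixteen/Twenty/TwentyFour`) give: the
PRIMITIVE CM types form ONE family under `Aut(K)` (Shimura §8.4 Example (1): `(ℤ/d)ˣ` acts simply transitively on the residue sets with
trivial stabiliser).  With the tree's «same family ⟺ isogenous» for realisations (`isIsogenous_of_isAutTransform`, Deligne §5 (b) ∕ Shimura
§6.1 Cor.; `isIsogenous_iff_isAutTransform_of_isGalois`, Koblitz–Rohrlich) and «simple ⟺ primitive» (`isSimple_iff_isPrimitive`):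

* `isAutTransform_of_isPrimitive_fifteen ∕ _sixteen ∕ _twenty` (the `ℚ(ζ₂₄)` case is the census's `isAutTransform_of_isPrimitive_twentyFour`),
  **`isAutTransform_of_isPrimitive_of_totient_eq_eight`**: any two primitive CM types of a cyclotomic field of degree `8` are transforms of
  each other by an automorphism of the field.
* **`isIsogenous_of_isSimple_of_totient_eq_eight`**: ANY TWO SIMPLE abelian varieties with complex multiplication by (CM types of) the same
  cyclotomic field of degree `8` are ISOGENOUS — one simple CM fourfold per field up to isogeny; `isIsogenous_iff_isAutTransform_of_totient_eq_eight`
  (all realisations: isogenous ⟺ types in one family), `not_isIsogenous_of_isSimple_of_not_isSimple_of_totient_eq_eight`.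

## References

* [Shimura1998] G. Shimura, *Abelian Varieties with Complex Multiplication and Modular Functions* (1998), §6.1 Cor., §8.2 Prop. 26, §8.4
  Example (1).
* [KoblitzRohrlich1978] N. Koblitz, D. Rohrlich, *Simple factors in the Jacobian of a Fermat curve*, Canad. J. Math. 30 (1978), §1 p. 1184.
* [Deligne1982HodgeCycles] P. Deligne, *Hodge cycles on abelian varieties*, LNM 900 (1982), §5 (b).
-/

noncomputable section

open scoped Classical NumberField
open NumberField CategoryTheory

namespace Literature.AlgebraicGeometry.ComplexMultiplication

namespace CyclotomicCMTypeCensusDegreeEight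

-- `open scoped`: the tree's action of `Aut(ℂ)` on `Hom(K, ℂ)` by composition (`ringEquivCompAction`) is a scoped instance
open scoped Literature.NumberTheory.ComplexMultiplication
open Literature.AlgebraicGeometry.Motives (CMType AbelianVariety)
open Literature.AlgebraicGeometry.Motives.AbelianVariety (IsIsogenous)
open Literature.AlgebraicGeometry.HodgeTheory (complexBetti)
open Literature.NumberTheory.ComplexMultiplication (IsPrimitive)
open CyclotomicCMTypeResidueSets (IsAutTransform)
open CyclotomicCMTypeCensusFifteen (exists_four_families_fifteen)
open CyclotomicCMTypeCensusSixteen (exists_four_families_sixteen)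
open CyclotomicCMTypeCensusTwenty (exists_four_families_twenty)
open CyclotomicCMTypeCensusTwentyFour (isAutTransform_of_isPrimitive_twentyFour)
open Literature.NumberTheory.Automorphic.Arthur2013.Leaves.TECR.TorusDict (isCyclotomicExtension_of_two_mul_of_odd)

variable {d : ℕ} {L : Type} [Field L] [NumberField L]
  {A A' : AbelianVariety ℂ} {ι : 𝓞 L →+* End A} {θ : L →+* Module.End ℂ (complexBetti A.X 1)}
  {ι' : 𝓞 L →+* End A'} {θ' : L →+* Module.End ℂ (complexBetti A'.X 1)}

/-! ### §1 The primitive types of a cyclotomic field of degree `8` form one family -/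

/-- **Any two primitive CM types of `ℚ(ζ_15)` are transforms of each other** (the primitive types form one family: the census's
representative `Φ₁` is a transform of both). [cite: Shimura1998, §8.4 Example (1)] -/
theorem isAutTransform_of_isPrimitive_fifteen (hL : IsCyclotomicExtension {15} ℚ L) {Φ Ψ : CMType L} (φ₀ : L →+* ℂ)
    (hΦ : IsPrimitive (ℂ ≃+* ℂ) Φ.1 φ₀) (hΨ : IsPrimitive (ℂ ≃+* ℂ) Ψ.1 φ₀) : IsAutTransform Φ Ψ := by
  obtain ⟨Φ₁, Φ₂, Φ₃, Φ₄, -, -, -, -, -, hp₂, hp₃, hp₄, -, -, -, -, -, -, hall⟩ := exists_four_families_fifteen (L := L) φ₀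
  have key : ∀ Θ : CMType L, IsPrimitive (ℂ ≃+* ℂ) Θ.1 φ₀ → IsAutTransform Φ₁ Θ := by
    intro Θ hΘ
    rcases hall Θ with h | h | h | h
    · exact h
    · exact absurd ((h.isPrimitive_iff 15 φ₀).1 hΘ) hp₂
    · exact absurd ((h.isPrimitive_iff 15 φ₀).1 hΘ) hp₃
    · exact absurd ((h.isPrimitive_iff 15 φ₀).1 hΘ) hp₄
  exact (key Φ hΦ).symm.trans (key Ψ hΨ)

/-- **Any two primitive CM types of `ℚ(ζ_16)` are transforms of each other** (the primitive types form one family: the census's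
representative `Φ₁` is a transform of both). [cite: Shimura1998, §8.4 Example (1)] -/
theorem isAutTransform_of_isPrimitive_sixteen (hL : IsCyclotomicExtension {16} ℚ L) {Φ Ψ : CMType L} (φ₀ : L →+* ℂ)
    (hΦ : IsPrimitive (ℂ ≃+* ℂ) Φ.1 φ₀) (hΨ : IsPrimitive (ℂ ≃+* ℂ) Ψ.1 φ₀) : IsAutTransform Φ Ψ := by
  obtain ⟨Φ₁, Φ₂, Φ₃, Φ₄, -, -, -, -, -, hp₂, hp₃, hp₄, -, -, -, -, -, -, hall⟩ := exists_four_families_sixteen (L := L) φ₀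
  have key : ∀ Θ : CMType L, IsPrimitive (ℂ ≃+* ℂ) Θ.1 φ₀ → IsAutTransform Φ₁ Θ := by
    intro Θ hΘ
    rcases hall Θ with h | h | h | h
    · exact h
    · exact absurd ((h.isPrimitive_iff 16 φ₀).1 hΘ) hp₂
    · exact absurd ((h.isPrimitive_iff 16 φ₀).1 hΘ) hp₃
    · exact absurd ((h.isPrimitive_iff 16 φ₀).1 hΘ) hp₄
  exact (key Φ hΦ).symm.trans (key Ψ hΨ)

/-- **Any two primitive CM types of `ℚ(ζ_20)` are transforms of each other** (the primitive types form one family: the census's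
representative `Φ₁` is a transform of both). [cite: Shimura1998, §8.4 Example (1)] -/
theorem isAutTransform_of_isPrimitive_twenty (hL : IsCyclotomicExtension {20} ℚ L) {Φ Ψ : CMType L} (φ₀ : L →+* ℂ)
    (hΦ : IsPrimitive (ℂ ≃+* ℂ) Φ.1 φ₀) (hΨ : IsPrimitive (ℂ ≃+* ℂ) Ψ.1 φ₀) : IsAutTransform Φ Ψ := by
  obtain ⟨Φ₁, Φ₂, Φ₃, Φ₄, -, -, -, -, -, hp₂, hp₃, hp₄, -, -, -, -, -, -, hall⟩ := exists_four_families_twenty (L := L) φ₀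
  have key : ∀ Θ : CMType L, IsPrimitive (ℂ ≃+* ℂ) Θ.1 φ₀ → IsAutTransform Φ₁ Θ := by
    intro Θ hΘ
    rcases hall Θ with h | h | h | h
    · exact h
    · exact absurd ((h.isPrimitive_iff 20 φ₀).1 hΘ) hp₂
    · exact absurd ((h.isPrimitive_iff 20 φ₀).1 hΘ) hp₃
    · exact absurd ((h.isPrimitive_iff 20 φ₀).1 hΘ) hp₄
  exact (key Φ hΦ).symm.trans (key Ψ hΨ)

/-- `ℚ(ζ₃₀) = ℚ(ζ₁₅)`. [folklore] -/
private theorem isCyclotomicExtension_fifteen_of_thirty₄₆ (hL : IsCyclotomicExtension {30} ℚ L) : IsCyclotomicExtension {15} ℚ L := by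
  haveI : IsCyclotomicExtension {2 * 15} ℚ L := hL
  exact isCyclotomicExtension_of_two_mul_of_odd (K := L) (by decide)

/-- **ANY TWO PRIMITIVE CM TYPES OF A CYCLOTOMIC FIELD OF DEGREE `8` ARE TRANSFORMS OF EACH OTHER BY A FIELD AUTOMORPHISM** (uniformly in
`d` with `φ(d) = 8`). [cite: Shimura1998, §8.4 Example (1)] -/
theorem isAutTransform_of_isPrimitive_of_totient_eq_eight (hL : IsCyclotomicExtension {d} ℚ L) (h8 : Nat.totient d = 8)
    {Φ Ψ : CMType L} (φ₀ : L →+* ℂ) (hΦ : IsPrimitive (ℂ ≃+* ℂ) Φ.1 φ₀) (hΨ : IsPrimitive (ℂ ≃+* ℂ) Ψ.1 φ₀) :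
    IsAutTransform Φ Ψ := by
  rcases eq_of_totient_eq_eight' h8 with rfl | rfl | rfl | rfl | rfl
  · exact isAutTransform_of_isPrimitive_fifteen hL φ₀ hΦ hΨ
  · exact isAutTransform_of_isPrimitive_sixteen hL φ₀ hΦ hΨ
  · exact isAutTransform_of_isPrimitive_twenty hL φ₀ hΦ hΨ
  · haveI := hL; exact isAutTransform_of_isPrimitive_twentyFour Φ Ψ φ₀ hΦ hΨ
  · exact isAutTransform_of_isPrimitive_fifteen (isCyclotomicExtension_fifteen_of_thirty₄₆ hL) φ₀ hΦ hΨ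

/-! ### §2 On abelian varieties -/

/-- **ANY TWO SIMPLE ABELIAN VARIETIES WITH COMPLEX MULTIPLICATION BY THE SAME CYCLOTOMIC FIELD OF DEGREE `8` ARE ISOGENOUS** (each realising
some CM type of `ℚ(ζ_d)`, `φ(d) = 8`): one simple CM fourfold per field, up to isogeny. [cite: Shimura1998, §6.1 Cor., §8.2 Prop. 26, §8.4 Example (1)]
[cite: Deligne1982HodgeCycles, §5 (b)] -/
theorem isIsogenous_of_isSimple_of_totient_eq_eight (hL : IsCyclotomicExtension {d} ℚ L) (h8 : Nat.totient d = 8)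
    {Φ Φ' : CMType L} (hA : IsCMTypeRealisation Φ A ι θ) (hA' : IsCMTypeRealisation Φ' A' ι' θ') (hs : A.IsSimple)
    (hs' : A'.IsSimple) : IsIsogenous A A' := by
  have hd2 : 2 < d := by
    by_contra hle
    interval_cases d <;> simp_all
  haveI : NeZero d := ⟨by omega⟩
  haveI : IsCMField L := IsCyclotomicExtension.Rat.isCMField L (S := ({d} : Set ℕ)) ⟨d, rfl, hd2⟩
  obtain ⟨φ₀⟩ : Nonempty (L →+* ℂ) := inferInstance
  exact isIsogenous_of_isAutTransform
    (isAutTransform_of_isPrimitive_of_totient_eq_eight hL h8 φ₀ ((isSimple_iff_isPrimitive hA φ₀).1 hs)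
      ((isSimple_iff_isPrimitive hA' φ₀).1 hs')) hA hA'

/-- **Isogeny classes = `Aut`-families of CM types**, for all abelian varieties with complex multiplication by a cyclotomic field of degree `8`
(simple or not; `ℚ(ζ_d)/ℚ` is Galois). [cite: KoblitzRohrlich1978, §1 p. 1184] [cite: Shimura1998, §8.4 Example (1), §6.1 Cor.] -/
theorem isIsogenous_iff_isAutTransform_of_totient_eq_eight (hL : IsCyclotomicExtension {d} ℚ L) (h8 : Nat.totient d = 8)
    {Φ Φ' : CMType L} (hA : IsCMTypeRealisation Φ A ι θ) (hA' : IsCMTypeRealisation Φ' A' ι' θ') :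
    IsIsogenous A A' ↔ IsAutTransform Φ Φ' := by
  have hd2 : 2 < d := by
    by_contra hle
    interval_cases d <;> simp_all
  haveI : NeZero d := ⟨by omega⟩
  haveI : IsCMField L := IsCyclotomicExtension.Rat.isCMField L (S := ({d} : Set ℕ)) ⟨d, rfl, hd2⟩
  haveI : IsGalois ℚ L := IsCyclotomicExtension.isGalois {d} ℚ L
  exact isIsogenous_iff_isAutTransform_of_isGalois hA hA'

/-- A simple and a non-simple abelian variety with complex multiplication by the same cyclotomic field of degree `8` are NOT isogenous (their
types lie in different families: primitivity is constant on families). [cite: Shimura1998, §8.2 Prop. 26, §8.4 Example (1)] -/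
theorem not_isIsogenous_of_isSimple_of_not_isSimple_of_totient_eq_eight (hL : IsCyclotomicExtension {d} ℚ L) (h8 : Nat.totient d = 8)
    {Φ Φ' : CMType L} (hA : IsCMTypeRealisation Φ A ι θ) (hA' : IsCMTypeRealisation Φ' A' ι' θ') (hs : A.IsSimple)
    (hs' : ¬ A'.IsSimple) : ¬ IsIsogenous A A' := by
  haveI : NeZero d := ⟨by rintro rfl; simp at h8⟩
  haveI := hL
  obtain ⟨φ₀⟩ : Nonempty (L →+* ℂ) := inferInstance
  intro h
  have hΦ : IsPrimitive (ℂ ≃+* ℂ) Φ.1 φ₀ := (isSimple_iff_isPrimitive hA φ₀).1 hs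
  have hΦ' : IsPrimitive (ℂ ≃+* ℂ) Φ'.1 φ₀ :=
    (((isIsogenous_iff_isAutTransform_of_totient_eq_eight hL h8 hA hA').1 h).isPrimitive_iff d φ₀).2 hΦ
  exact hs' ((isSimple_iff_isPrimitive hA' φ₀).2 hΦ')

end CyclotomicCMTypeCensusDegreeEight

end Literature.AlgebraicGeometry.ComplexMultiplication

end
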